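import Literature.NumberTheory.LFunctions.UniformClassGroupZeroSum
import Literature.NumberTheory.LFunctions.ClassGroupSmoothedPsi
import Literature.NumberTheory.LFunctions.ClassGroupExplicitFormulaBounds
import Literature.NumberTheory.LFunctions.ClassGroupPsiErrorTerm
import HarnessLib

/-!
# The additive class prime number theorem, III: the smoothed class sums through the explicit
# formulae of the whole family, two-sided, with the exceptional zeros kept

Topic `Summits/QuantumAdvantage/QuantumAdvantage/Theorems`, cell B2b-1 (linnik-cubic), PART A, the
`stub_classPNTAdditive` slice of the crux `DegreeOnePrimesEscape` (stmt-QuantumAdvantage-11543), in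
DEGREE-LOCAL form.  HONEST FRAMING: the value of this file is a THEOREM — not summit progress.

For a number field `K`, a class `C`, the weight `g = tzTest (log x) ε`, its Laplace transform `F` and the
family `F_ψ` (`ψ ∈ Ĉl_K`; `F_0 = ζ₁_K`, `F_ψ = L₀(·,χ_ψ)`), orthogonality
(`classNumber_mul_smoothedPsiClass`) and the explicit formulae (`coefFordK_one_eq_explicit`,
`coefFordK_eq_explicit`) give, TWO-SIDEDLY and with a prescribed finite set `Exc ψ` of non-trivial zeros
of `F_ψ` kept on the main-term side,

  `‖h ψ̃_C(g) − F(−1) + Σ_ψ ψ(C⁻¹) Σ_{ρ ∈ Exc ψ} m_ψ(ρ) F(−ρ)‖ ≤ B + h (M₀ + J)`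

(`norm_classNumber_mul_smoothedPsiClass_sub_le`), where `B` bounds the zero terms `Σ_ψ Σ m‖F(−ρ)‖` over
the zeros NOT in `Exc ψ` (all finite partial sums, as supplied by `fam_zeroSum_le_local`), `M₀` the
trivial-zero terms `m_ψ(0)(L + ε)` and `J` the left-line integrals.  Ingredients: the abstract two-sided
reading of one explicit formula (`norm_explicit_core`), its instance for `F_ψ` (`norm_coefFordK_famF_sub_le`),
and a supremum lemma (`sum_ciSup_le_of_forall_sum_le`) passing the FAMILY bound for finite partial sums to
the sum over `ψ` of the per-character suprema.
-/

noncomputable section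

open Complex Real MeasureTheory Set Filter Topology
open scoped NumberField nonZeroDivisors

namespace Summit.QuantumAdvantage.QuantumAdvantage.Theorems.DegreeOnePrimesEscape

open Literature.NumberTheory.LFunctions Literature.NumberTheory.LFunctions.NumberField
  Literature.NumberTheory.LFunctions.EntireEF Literature.NumberTheory.LFunctions.TZWeight
  Literature.NumberTheory.LFunctions.AbelianDensity

/-! ### The abstract two-sided reading of one explicit formula -/

/-- **Two-sided reading of an explicit formula with prescribed exceptional zeros.**  If
`Kv = main − Σ'_ρ m(ρ) F₀(0 − ρ) − m₀ F₀(0) + J` (sum over the non-trivial zeros of `f`, absolutely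
convergent), `Exc` is a finite set of non-trivial zeros, every finite partial sum of `m ‖F(−ρ)‖` over the
non-trivial zeros outside `Exc` is `≤ B`, and `‖F₀(0)‖ ≤ F0`, then
`‖Kv − main + Σ_{ρ ∈ Exc} m(ρ) F(−ρ)‖ ≤ B + m₀ F0 + ‖J‖` (`F₀ = F` as `g(0) = 0`). -/
theorem norm_explicit_core {f : ℂ → ℂ} {g : ℝ → ℝ} (hg0 : g 0 = 0) {Kv main J : ℂ} {F0 : ℝ}
    (hsum : Summable fun ρ : nontrivialZeros f ↦
      ‖(analyticOrderNatAt f (ρ : ℂ) : ℂ) * fordLaplace₀ g (0 - (ρ : ℂ))‖)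
    (hK : Kv = main - (∑' ρ : nontrivialZeros f,
        (analyticOrderNatAt f (ρ : ℂ) : ℂ) * fordLaplace₀ g (0 - (ρ : ℂ))) -
        (analyticOrderNatAt f 0 : ℂ) * fordLaplace₀ g 0 + J)
    (hF0 : ‖fordLaplace₀ g 0‖ ≤ F0)
    (Exc : Finset ℂ) (hExc : ∀ ρ ∈ Exc, f ρ = 0 ∧ 0 < ρ.re ∧ ρ.re < 1)
    {B : ℝ} (hB : ∀ u : Finset ℂ, (∀ ρ ∈ u, f ρ = 0 ∧ 0 < ρ.re ∧ ρ.re < 1) →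
      ∑ ρ ∈ u with ρ ∉ Exc, (analyticOrderNatAt f ρ : ℝ) * ‖fordLaplace g (-ρ)‖ ≤ B) :
    ‖Kv - main + ∑ ρ ∈ Exc, (analyticOrderNatAt f ρ : ℂ) * fordLaplace g (-ρ)‖ ≤
      B + (analyticOrderNatAt f 0 : ℝ) * F0 + ‖J‖ := by
  classical
  set a : nontrivialZeros f → ℂ := fun ρ ↦
    (analyticOrderNatAt f (ρ : ℂ) : ℂ) * fordLaplace₀ g (0 - (ρ : ℂ)) with ha
  have ha_eq : ∀ ρ : nontrivialZeros f,
      a ρ = (analyticOrderNatAt f (ρ : ℂ) : ℂ) * fordLaplace g (-(ρ : ℂ)) := by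
    intro ρ; rw [ha]; dsimp only; rw [zero_sub, fordLaplace₀_eq_fordLaplace hg0]
  have hna_eq : ∀ ρ : nontrivialZeros f,
      ‖a ρ‖ = (analyticOrderNatAt f (ρ : ℂ) : ℝ) * ‖fordLaplace g (-(ρ : ℂ))‖ := by
    intro ρ; rw [ha_eq, norm_mul, Complex.norm_natCast]
  -- split `a` into the exceptional and the non-exceptional part
  set aE : nontrivialZeros f → ℂ := fun ρ ↦ if (ρ : ℂ) ∈ Exc then a ρ else 0 with haE
  set aN : nontrivialZeros f → ℂ := fun ρ ↦ if (ρ : ℂ) ∈ Exc then 0 else a ρ with haN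
  have hsplit : ∀ ρ, a ρ = aE ρ + aN ρ := fun ρ ↦ by
    rw [haE, haN]; dsimp only; split_ifs <;> simp
  have hsum' : Summable a := hsum.of_norm
  have hEle : ∀ ρ, ‖aE ρ‖ ≤ ‖a ρ‖ := fun ρ ↦ by
    rw [haE]; dsimp only; split_ifs
    · exact le_rfl
    · rw [norm_zero]; exact norm_nonneg _
  have hNle : ∀ ρ, ‖aN ρ‖ ≤ ‖a ρ‖ := fun ρ ↦ by
    rw [haN]; dsimp only; split_ifs
    · rw [norm_zero]; exact norm_nonneg _
    · exact le_rfl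
  have hsumE : Summable aE := Summable.of_norm_bounded hsum hEle
  have hsumNn : Summable (fun ρ ↦ ‖aN ρ‖) := Summable.of_nonneg_of_le (fun _ ↦ norm_nonneg _) hNle hsum
  have hsumN : Summable aN := hsumNn.of_norm
  have htsum : ∑' ρ, a ρ = ∑' ρ, aE ρ + ∑' ρ, aN ρ := by
    rw [← hsumE.tsum_add hsumN]; exact tsum_congr hsplit
  -- the exceptional part is the finite sum over `Exc`
  set Exc' : Finset (nontrivialZeros f) := Exc.subtype (· ∈ nontrivialZeros f) with hExc'
  have hEfin : ∑' ρ, aE ρ = ∑ ρ ∈ Exc, (analyticOrderNatAt f ρ : ℂ) * fordLaplace g (-ρ) := by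
    rw [tsum_eq_sum (s := Exc') (fun ρ hρ ↦ ?_)]
    · have h1 : ∑ ρ ∈ Exc', aE ρ =
          ∑ ρ ∈ Exc', (fun ρ : ℂ ↦ (analyticOrderNatAt f ρ : ℂ) * fordLaplace g (-ρ)) (ρ : ℂ) := by
        refine Finset.sum_congr rfl fun ρ hρ ↦ ?_
        rw [hExc', Finset.mem_subtype] at hρ
        rw [haE]; dsimp only; rw [if_pos hρ, ha_eq]
      rw [h1, hExc', Finset.sum_subtype_of_mem (p := (· ∈ nontrivialZeros f))
        (fun ρ : ℂ ↦ (analyticOrderNatAt f ρ : ℂ) * fordLaplace g (-ρ)) (fun ρ hρ ↦ hExc ρ hρ)]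
    · rw [hExc', Finset.mem_subtype] at hρ
      rw [haE]; dsimp only; rw [if_neg hρ]
  -- the non-exceptional part is bounded by `B`
  have hNB : ‖∑' ρ, aN ρ‖ ≤ B := by
    refine (norm_tsum_le_tsum_norm hsumNn).trans (hsumNn.tsum_le_of_sum_le fun s ↦ ?_)
    have hinj : Set.InjOn (Subtype.val : nontrivialZeros f → ℂ) ↑s := fun a _ b _ h ↦ Subtype.ext h
    have hBs := hB (s.image Subtype.val) (fun ρ hρ ↦ ?_)
    · refine le_trans (le_of_eq ?_) hBs
      rw [Finset.sum_filter, Finset.sum_image hinj]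
      refine Finset.sum_congr rfl fun ρ _ ↦ ?_
      rw [haN]; dsimp only
      by_cases hmem : (ρ : ℂ) ∈ Exc
      · rw [if_pos hmem, if_neg (not_not.2 hmem), norm_zero]
      · rw [if_neg hmem, if_pos hmem, hna_eq]
    · obtain ⟨ρ', _, rfl⟩ := Finset.mem_image.1 hρ
      exact ρ'.2
  -- the trivial zero
  have hm₀ : ‖(analyticOrderNatAt f 0 : ℂ) * fordLaplace₀ g 0‖ ≤ (analyticOrderNatAt f 0 : ℝ) * F0 := by
    rw [norm_mul, Complex.norm_natCast]
    exact mul_le_mul_of_nonneg_left hF0 (Nat.cast_nonneg _)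
  -- assemble
  have hid : Kv - main + ∑ ρ ∈ Exc, (analyticOrderNatAt f ρ : ℂ) * fordLaplace g (-ρ) =
      -(∑' ρ, aN ρ) - (analyticOrderNatAt f 0 : ℂ) * fordLaplace₀ g 0 + J := by
    rw [hK, htsum, hEfin]; ring
  rw [hid]
  calc ‖-(∑' ρ, aN ρ) - (analyticOrderNatAt f 0 : ℂ) * fordLaplace₀ g 0 + J‖
      ≤ ‖-(∑' ρ, aN ρ) - (analyticOrderNatAt f 0 : ℂ) * fordLaplace₀ g 0‖ + ‖J‖ := norm_add_le _ _
    _ ≤ ‖-(∑' ρ, aN ρ)‖ + ‖(analyticOrderNatAt f 0 : ℂ) * fordLaplace₀ g 0‖ + ‖J‖ :=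
        add_le_add (norm_sub_le _ _) le_rfl
    _ ≤ B + (analyticOrderNatAt f 0 : ℝ) * F0 + ‖J‖ := by
        rw [norm_neg]; exact add_le_add (add_le_add hNB hm₀) le_rfl

/-! ### The instance for the family `F_ψ` -/

variable {K : Type} [Field K] [NumberField K]

/-- **The explicit formula of `F_ψ` read two-sidedly, exceptional zeros kept.**  For `ψ ∈ Ĉl_K`, `x > 1`,
`0 < ε < (log x)/2`, `g = tzTest (log x) ε`, a finite set `Exc` of non-trivial zeros of `F_ψ`, a bound `B`
for the finite partial sums of `m_ψ ‖F(−ρ)‖` over the non-trivial zeros outside `Exc`, and bounds `M₀`, `J`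
for the trivial-zero term `m_ψ(0)(log x + ε)` and the left-line integral:
`‖K_{χ_ψ}(g) − [ψ = 0] F(−1) + Σ_{ρ ∈ Exc} m_ψ(ρ) F(−ρ)‖ ≤ B + M₀ + J`. -/
theorem norm_coefFordK_famF_sub_le (ψ : AddChar (Additive (ClassGroup (𝓞 K))) ℂ) {x ε : ℝ}
    (hx : 1 < x) (hε : 0 < ε) (hεL : ε < Real.log x / 2)
    (Exc : Finset ℂ) (hExc : ∀ ρ ∈ Exc, famF K ψ ρ = 0 ∧ 0 < ρ.re ∧ ρ.re < 1)
    {B M₀ J : ℝ}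
    (hB : ∀ u : Finset ℂ, (∀ ρ ∈ u, famF K ψ ρ = 0 ∧ 0 < ρ.re ∧ ρ.re < 1) →
      ∑ ρ ∈ u with ρ ∉ Exc, (famMult K ψ ρ : ℝ) * ‖fordLaplace (tzTest (Real.log x) ε) (-ρ)‖ ≤ B)
    (hM₀ : (famMult K ψ 0 : ℝ) * (Real.log x + ε) ≤ M₀)
    (hJ0 : ψ = 0 → ‖dzEFRemainder K (tzTest (Real.log x) ε) 0‖ ≤ J)
    (hJ : ψ ≠ 0 → ‖cgEFRemainder (toMulHom ψ).toHomUnits (tzTest (Real.log x) ε) 0‖ ≤ J) :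
    ‖coefFordK (cgCoef (toMulHom ψ).toHomUnits) (tzTest (Real.log x) ε) 0 -
        (if ψ = 0 then fordLaplace (tzTest (Real.log x) ε) (-1) else 0) +
        ∑ ρ ∈ Exc, (famMult K ψ ρ : ℂ) * fordLaplace (tzTest (Real.log x) ε) (-ρ)‖ ≤
      B + M₀ + J := by
  set Lx := Real.log x with hLx
  have hL : 0 < Lx := Real.log_pos hx
  have hadm := isSmoothedEFTest_tzTest hL hε
  have hg0 : tzTest Lx ε 0 = 0 := tzTest_zero hL hε hεL.le
  have hF0 : ‖fordLaplace₀ (tzTest Lx ε) 0‖ ≤ Lx + ε := by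
    rw [fordLaplace₀_eq_fordLaplace hg0]; exact norm_fordLaplace_tzTest_zero_le hL hε hεL
  by_cases hψ : ψ = 0
  · -- `ψ = 0`: `F_0 = ζ₁_K`
    subst hψ
    simp only [if_true]
    have hsz : ∀ ρ : ℂ, dedekindZeta₁ K ρ = 0 → 0 < ρ.re → ρ.re < 1 → ρ ≠ 0 := by
      intro ρ _ h1 _ h; rw [h] at h1; simp at h1
    have hexpl := coefFordK_one_eq_explicit (K := K) hadm hg0 (s := 0) (by norm_num) (by norm_num) hsz
    have hsum := summable_norm_dzZeroTerm (K := K) hadm (s := 0) (by norm_num) hsz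
    have hExc' : ∀ ρ ∈ Exc, dedekindZeta₁ K ρ = 0 ∧ 0 < ρ.re ∧ ρ.re < 1 := by
      intro ρ hρ; have := hExc ρ hρ; rwa [famF_zero] at this
    have hB' : ∀ u : Finset ℂ, (∀ ρ ∈ u, dedekindZeta₁ K ρ = 0 ∧ 0 < ρ.re ∧ ρ.re < 1) →
        ∑ ρ ∈ u with ρ ∉ Exc, (analyticOrderNatAt (dedekindZeta₁ K) ρ : ℝ) *
          ‖fordLaplace (tzTest Lx ε) (-ρ)‖ ≤ B := by
      intro u hu
      have := hB u (fun ρ hρ ↦ by rw [famF_zero]; exact hu ρ hρ)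
      simpa only [famMult, famF_zero] using this
    have hmain : fordLaplace₀ (tzTest Lx ε) (0 - 1) = fordLaplace (tzTest Lx ε) (-1) := by
      rw [zero_sub, fordLaplace₀_eq_fordLaplace hg0]
    rw [hmain] at hexpl
    have key := norm_explicit_core hg0 hsum hexpl hF0 Exc hExc' hB'
    have hm : (famMult K 0 0 : ℝ) = (analyticOrderNatAt (dedekindZeta₁ K) 0 : ℝ) := by
      rw [famMult, famF_zero]
    rw [hm] at hM₀
    have hJ' := hJ0 rfl
    have hcoef : coefFordK (cgCoef (toMulHom (0 : AddChar (Additive (ClassGroup (𝓞 K))) ℂ)).toHomUnits)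
        (tzTest Lx ε) 0 = coefFordK (cgCoef (1 : ClassGroup (𝓞 K) →* ℂˣ)) (tzTest Lx ε) 0 := by
      rw [toHomUnits_toMulHom_zero]
    have hsumE : ∑ ρ ∈ Exc, (famMult K 0 ρ : ℂ) * fordLaplace (tzTest Lx ε) (-ρ) =
        ∑ ρ ∈ Exc, (analyticOrderNatAt (dedekindZeta₁ K) ρ : ℂ) * fordLaplace (tzTest Lx ε) (-ρ) := by
      refine Finset.sum_congr rfl fun ρ _ ↦ ?_
      rw [famMult, famF_zero]
    rw [hcoef, hsumE]
    refine key.trans ?_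
    have := mul_le_mul_of_nonneg_left hF0 (Nat.cast_nonneg (analyticOrderNatAt (dedekindZeta₁ K) 0))
    linarith
  · -- `ψ ≠ 0`: `F_ψ = L₀(·, χ_ψ)`
    simp only [hψ, if_false, sub_zero]
    set χ : ClassGroup (𝓞 K) →* ℂˣ := (toMulHom ψ).toHomUnits with hχdef
    have hχ : χ ≠ 1 := toHomUnits_ne_one hψ
    have hsz : ∀ ρ : ℂ, classGroupLFunction₀ K χ ρ = 0 → 0 < ρ.re → ρ.re < 1 → ρ ≠ 0 := by
      intro ρ _ h1 _ h; rw [h] at h1; simp at h1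
    have hexpl := coefFordK_eq_explicit hχ hadm hg0 (s := 0) (by norm_num) (by norm_num) hsz
    have hsum := summable_norm_cgZeroTerm hχ hadm (s := 0) (by norm_num) hsz
    have hExc' : ∀ ρ ∈ Exc, classGroupLFunction₀ K χ ρ = 0 ∧ 0 < ρ.re ∧ ρ.re < 1 := by
      intro ρ hρ; have := hExc ρ hρ; rwa [famF_of_ne hψ] at this
    have hB' : ∀ u : Finset ℂ, (∀ ρ ∈ u, classGroupLFunction₀ K χ ρ = 0 ∧ 0 < ρ.re ∧ ρ.re < 1) →
        ∑ ρ ∈ u with ρ ∉ Exc, (analyticOrderNatAt (classGroupLFunction₀ K χ) ρ : ℝ) *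
          ‖fordLaplace (tzTest Lx ε) (-ρ)‖ ≤ B := by
      intro u hu
      have := hB u (fun ρ hρ ↦ by rw [famF_of_ne hψ]; exact hu ρ hρ)
      simpa only [famMult, famF_of_ne hψ] using this
    have hexpl' : coefFordK (cgCoef χ) (tzTest Lx ε) 0 = 0 -
        (∑' ρ : nontrivialZeros (classGroupLFunction₀ K χ),
          (analyticOrderNatAt (classGroupLFunction₀ K χ) (ρ : ℂ) : ℂ) * fordLaplace₀ (tzTest Lx ε) (0 - ρ)) -
        (analyticOrderNatAt (classGroupLFunction₀ K χ) 0 : ℂ) * fordLaplace₀ (tzTest Lx ε) 0 +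
        cgEFRemainder χ (tzTest Lx ε) 0 := by
      rw [hexpl]; ring
    have key := norm_explicit_core hg0 hsum hexpl' hF0 Exc hExc' hB'
    have hm : (famMult K ψ 0 : ℝ) = (analyticOrderNatAt (classGroupLFunction₀ K χ) 0 : ℝ) := by
      rw [famMult, famF_of_ne hψ]
    rw [hm] at hM₀
    have hJ' := hJ hψ
    have hsumE : ∑ ρ ∈ Exc, (famMult K ψ ρ : ℂ) * fordLaplace (tzTest Lx ε) (-ρ) =
        ∑ ρ ∈ Exc, (analyticOrderNatAt (classGroupLFunction₀ K χ) ρ : ℂ) * fordLaplace (tzTest Lx ε) (-ρ) := by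
      refine Finset.sum_congr rfl fun ρ _ ↦ ?_
      rw [famMult, famF_of_ne hψ]
    rw [hsumE]
    rw [sub_zero] at key
    refine key.trans ?_
    have := mul_le_mul_of_nonneg_left hF0 (Nat.cast_nonneg (analyticOrderNatAt (classGroupLFunction₀ K χ) 0))
    linarith

/-! ### From the family bound for finite partial sums to the sum of the suprema -/

/-- **Supremum lemma.**  For a finite index type `ι`, a nonempty type `σ` and `P : ι → σ → ℝ` with
`Σ_i P i (u i) ≤ B` for every `u : ι → σ`: `Σ_i ⨆_u P i u ≤ B` (each `P i` is then bounded above). -/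
theorem sum_ciSup_le_of_forall_sum_le {ι σ : Type*} [Fintype ι] [Nonempty σ] (P : ι → σ → ℝ)
    (hP0 : ∀ i u, 0 ≤ P i u) {B : ℝ} (hB : ∀ u : ι → σ, ∑ i, P i (u i) ≤ B) :
    ∑ i, ⨆ u, P i u ≤ B := by
  classical
  obtain ⟨u₀⟩ := ‹Nonempty σ›
  -- each `P i` is bounded above by `B`
  have hbdd : ∀ i, BddAbove (Set.range (P i)) := by
    intro i
    refine ⟨B, ?_⟩
    rintro _ ⟨u, rfl⟩
    have h := hB (Function.update (fun _ ↦ u₀) i u)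
    have hle : P i u ≤ ∑ j, P j (Function.update (fun _ ↦ u₀) i u j) := by
      rw [← Finset.sum_erase_add _ _ (Finset.mem_univ i)]
      simp only [Function.update_self]
      have : 0 ≤ ∑ j ∈ Finset.univ.erase i, P j (Function.update (fun _ ↦ u₀) i u j) :=
        Finset.sum_nonneg fun j _ ↦ hP0 _ _
      linarith
    exact hle.trans h
  refine le_of_forall_pos_le_add fun δ hδ ↦ ?_
  -- choose, for each `i`, an almost-maximiser
  have hδ' : 0 < δ / (Fintype.card ι + 1) := by positivity
  have hchoice : ∀ i, ∃ u, ⨆ v, P i v ≤ P i u + δ / (Fintype.card ι + 1) := by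
    intro i
    have hlt : (⨆ v, P i v) - δ / (Fintype.card ι + 1) < ⨆ v, P i v := by linarith
    obtain ⟨u, hu⟩ := exists_lt_of_lt_ciSup hlt
    exact ⟨u, by linarith⟩
  choose u hu using hchoice
  calc ∑ i, ⨆ v, P i v ≤ ∑ i, (P i (u i) + δ / (Fintype.card ι + 1)) := Finset.sum_le_sum fun i _ ↦ hu i
    _ = ∑ i, P i (u i) + Fintype.card ι * (δ / (Fintype.card ι + 1)) := by
        rw [Finset.sum_add_distrib, Finset.sum_const, nsmul_eq_mul, Finset.card_univ]
    _ ≤ B + δ := by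
        have h1 := hB u
        have h2 : (Fintype.card ι : ℝ) * (δ / (Fintype.card ι + 1)) ≤ δ := by
          rw [mul_div_assoc', div_le_iff₀ (by positivity)]; nlinarith
        linarith

/-! ### The assembly over the family -/

set_option maxHeartbeats 800000 in
/-- **The smoothed class sum through the family, two-sided, exceptional zeros kept.**  For `x > 1`,
`0 < ε < (log x)/2`, `g = tzTest (log x) ε`, a class `C`, finite sets `Exc ψ` of non-trivial zeros of
`F_ψ` containing all those in the exceptional segment `excRegion c K`, a FAMILY bound `Bf` for the finite
partial sums of the zero terms off the segment (the conclusion of `fam_zeroSum_le_local`), and bounds `M₀`,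
`J` for the trivial-zero terms and the left-line integrals of every member:
`‖h ψ̃_C(g) − F(−1) + Σ_ψ ψ(C⁻¹) Σ_{ρ ∈ Exc ψ} m_ψ(ρ) F(−ρ)‖ ≤ Bf + h (M₀ + J)`. -/
theorem norm_classNumber_mul_smoothedPsiClass_sub_le {x ε c : ℝ} (hx : 1 < x) (hε : 0 < ε)
    (hεL : ε < Real.log x / 2) (C : ClassGroup (𝓞 K))
    (Exc : AddChar (Additive (ClassGroup (𝓞 K))) ℂ → Finset ℂ)
    (hExc : ∀ ψ, ∀ ρ ∈ Exc ψ, famF K ψ ρ = 0 ∧ 0 < ρ.re ∧ ρ.re < 1)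
    (hExc' : ∀ ψ ρ, famF K ψ ρ = 0 → 0 < ρ.re → ρ.re < 1 → excRegion c K ρ → ρ ∈ Exc ψ)
    {Bf M₀ J : ℝ}
    (hBf : ∀ u : AddChar (Additive (ClassGroup (𝓞 K))) ℂ → Finset ℂ,
        (∀ ψ, ∀ ρ ∈ u ψ, famF K ψ ρ = 0 ∧ 0 < ρ.re ∧ ρ.re < 1) →
        ∑ ψ, ∑ ρ ∈ u ψ with ¬ excRegion c K ρ,
            (famMult K ψ ρ : ℝ) * ‖fordLaplace (tzTest (Real.log x) ε) (-ρ)‖ ≤ Bf)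
    (hM₀ : ∀ ψ, (famMult K ψ 0 : ℝ) * (Real.log x + ε) ≤ M₀)
    (hJ0 : ‖dzEFRemainder K (tzTest (Real.log x) ε) 0‖ ≤ J)
    (hJ : ∀ ψ : AddChar (Additive (ClassGroup (𝓞 K))) ℂ, ψ ≠ 0 →
      ‖cgEFRemainder (toMulHom ψ).toHomUnits (tzTest (Real.log x) ε) 0‖ ≤ J) :
    ‖(NumberField.classNumber K : ℂ) * (smoothedPsiClass K C (tzTest (Real.log x) ε) : ℂ) -
        fordLaplace (tzTest (Real.log x) ε) (-1) +
        ∑ ψ : AddChar (Additive (ClassGroup (𝓞 K))) ℂ, ψ (Additive.ofMul C⁻¹) *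
          ∑ ρ ∈ Exc ψ, (famMult K ψ ρ : ℂ) * fordLaplace (tzTest (Real.log x) ε) (-ρ)‖ ≤
      Bf + (NumberField.classNumber K : ℝ) * (M₀ + J) := by
  classical
  set Lx := Real.log x with hLx
  have hL : 0 < Lx := Real.log_pos hx
  set g := tzTest Lx ε with hg
  have hg0' : ∀ u, Lx + ε ≤ u → g u = 0 := fun u hu ↦ tzTest_eq_zero_of_ge hL hε hu
  -- the per-character suprema
  set P : AddChar (Additive (ClassGroup (𝓞 K))) ℂ → Finset ℂ → ℝ := fun ψ u ↦
    ∑ ρ ∈ u with ((famF K ψ ρ = 0 ∧ 0 < ρ.re ∧ ρ.re < 1) ∧ ρ ∉ Exc ψ),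
      (famMult K ψ ρ : ℝ) * ‖fordLaplace g (-ρ)‖ with hP
  have hP0 : ∀ ψ u, 0 ≤ P ψ u := fun ψ u ↦
    Finset.sum_nonneg fun ρ _ ↦ mul_nonneg (Nat.cast_nonneg _) (norm_nonneg _)
  have hPB : ∀ u : AddChar (Additive (ClassGroup (𝓞 K))) ℂ → Finset ℂ, ∑ ψ, P ψ (u ψ) ≤ Bf := by
    intro u
    have h := hBf (fun ψ ↦ (u ψ).filter (fun ρ ↦ famF K ψ ρ = 0 ∧ 0 < ρ.re ∧ ρ.re < 1))
      (fun ψ ρ hρ ↦ (Finset.mem_filter.1 hρ).2)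
    refine le_trans (Finset.sum_le_sum fun ψ _ ↦ ?_) h
    rw [hP]; dsimp only
    rw [Finset.filter_filter]
    refine Finset.sum_le_sum_of_subset_of_nonneg (fun ρ hρ ↦ ?_)
      fun ρ _ _ ↦ mul_nonneg (Nat.cast_nonneg _) (norm_nonneg _)
    rw [Finset.mem_filter] at hρ ⊢
    refine ⟨hρ.1, hρ.2.1, fun hexc ↦ hρ.2.2 (hExc' ψ ρ hρ.2.1.1 hρ.2.1.2.1 hρ.2.1.2.2 hexc)⟩
  have hsup := sum_ciSup_le_of_forall_sum_le P hP0 hPB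
  have hbdd : ∀ ψ, BddAbove (Set.range (P ψ)) := by
    intro ψ
    refine ⟨Bf, ?_⟩
    rintro _ ⟨u, rfl⟩
    have h := hPB (Function.update (fun _ ↦ (∅ : Finset ℂ)) ψ u)
    have hle : P ψ u ≤ ∑ φ, P φ (Function.update (fun _ ↦ (∅ : Finset ℂ)) ψ u φ) := by
      rw [← Finset.sum_erase_add _ _ (Finset.mem_univ ψ)]
      simp only [Function.update_self]
      have : 0 ≤ ∑ φ ∈ Finset.univ.erase ψ, P φ (Function.update (fun _ ↦ (∅ : Finset ℂ)) ψ u φ) :=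
        Finset.sum_nonneg fun φ _ ↦ hP0 _ _
      linarith
    exact hle.trans h
  -- the per-character estimate with `B_ψ = ⨆_u P ψ u`
  have hper : ∀ ψ : AddChar (Additive (ClassGroup (𝓞 K))) ℂ,
      ‖coefFordK (cgCoef (toMulHom ψ).toHomUnits) g 0 - (if ψ = 0 then fordLaplace g (-1) else 0) +
          ∑ ρ ∈ Exc ψ, (famMult K ψ ρ : ℂ) * fordLaplace g (-ρ)‖ ≤ (⨆ u, P ψ u) + M₀ + J := by
    intro ψ
    refine norm_coefFordK_famF_sub_le ψ hx hε hεL (Exc ψ) (hExc ψ) (fun u hu ↦ ?_) (hM₀ ψ)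
      (fun _ ↦ hJ0) (fun h0 ↦ hJ ψ h0)
    refine le_trans (le_of_eq ?_) (le_ciSup (hbdd ψ) u)
    rw [hP]; dsimp only
    refine Finset.sum_congr (Finset.filter_congr fun ρ hρ ↦ ?_) fun _ _ ↦ rfl
    exact ⟨fun h ↦ ⟨hu ρ hρ, h⟩, fun h ↦ h.2⟩
  -- orthogonality
  have horth := classNumber_mul_smoothedPsiClass (K := K) C hg0'
  have hmain : ∑ ψ : AddChar (Additive (ClassGroup (𝓞 K))) ℂ,
      ψ (Additive.ofMul C⁻¹) * (if ψ = 0 then fordLaplace g (-1) else 0) = fordLaplace g (-1) := by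
    rw [Finset.sum_eq_single (0 : AddChar (Additive (ClassGroup (𝓞 K))) ℂ)]
    · rw [if_pos rfl, AddChar.zero_apply, one_mul]
    · intro ψ _ hψ; rw [if_neg hψ, mul_zero]
    · intro h; exact absurd (Finset.mem_univ _) h
  have hid : (NumberField.classNumber K : ℂ) * (smoothedPsiClass K C g : ℂ) - fordLaplace g (-1) +
      ∑ ψ : AddChar (Additive (ClassGroup (𝓞 K))) ℂ, ψ (Additive.ofMul C⁻¹) *
        ∑ ρ ∈ Exc ψ, (famMult K ψ ρ : ℂ) * fordLaplace g (-ρ) =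
      ∑ ψ : AddChar (Additive (ClassGroup (𝓞 K))) ℂ, ψ (Additive.ofMul C⁻¹) *
        (coefFordK (cgCoef (toMulHom ψ).toHomUnits) g 0 - (if ψ = 0 then fordLaplace g (-1) else 0) +
          ∑ ρ ∈ Exc ψ, (famMult K ψ ρ : ℂ) * fordLaplace g (-ρ)) := by
    rw [horth]
    simp only [mul_add, mul_sub, Finset.sum_add_distrib, Finset.sum_sub_distrib, hmain]
  rw [hid]
  calc ‖∑ ψ : AddChar (Additive (ClassGroup (𝓞 K))) ℂ, ψ (Additive.ofMul C⁻¹) *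
        (coefFordK (cgCoef (toMulHom ψ).toHomUnits) g 0 - (if ψ = 0 then fordLaplace g (-1) else 0) +
          ∑ ρ ∈ Exc ψ, (famMult K ψ ρ : ℂ) * fordLaplace g (-ρ))‖
      ≤ ∑ ψ : AddChar (Additive (ClassGroup (𝓞 K))) ℂ, ‖ψ (Additive.ofMul C⁻¹) *
        (coefFordK (cgCoef (toMulHom ψ).toHomUnits) g 0 - (if ψ = 0 then fordLaplace g (-1) else 0) +
          ∑ ρ ∈ Exc ψ, (famMult K ψ ρ : ℂ) * fordLaplace g (-ρ))‖ := norm_sum_le _ _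
    _ ≤ ∑ ψ : AddChar (Additive (ClassGroup (𝓞 K))) ℂ, ((⨆ u, P ψ u) + M₀ + J) := by
        refine Finset.sum_le_sum fun ψ _ ↦ ?_
        rw [norm_mul, norm_addChar_apply, one_mul]
        exact hper ψ
    _ = ∑ ψ : AddChar (Additive (ClassGroup (𝓞 K))) ℂ, (⨆ u, P ψ u) +
          (NumberField.classNumber K : ℝ) * (M₀ + J) := by
        rw [Finset.sum_add_distrib, Finset.sum_add_distrib, Finset.sum_const, Finset.sum_const,
          nsmul_eq_mul, nsmul_eq_mul, Finset.card_univ, card_addChar_classGroup]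
        ring
    _ ≤ Bf + (NumberField.classNumber K : ℝ) * (M₀ + J) := add_le_add hsup le_rfl

end Summit.QuantumAdvantage.QuantumAdvantage.Theorems.DegreeOnePrimesEscape

end
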